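import Literature.Analysis.FluidPDE.VorticityCalculus
import Literature.Analysis.FluidPDE.TaoLocalVelocityGradient
import HarnessLib

/-!
# Crux `NearExtremalTransiencePerFlow` (stmt-NavierStokesRegularity-26567), LINE g13-β `relay` — ANNEX L1 on the Theorems side:
# exact sub-convexity of the depletion quotient for disjointly supported cells («has-beens keep their weight», exact form)

Theorems file (`--supports stmt-NavierStokesRegularity-26567`, helper; prover seat ns-net-p1 g17) porting VERBATIM the planner's annex
`Cruxes/NearExtremalTransiencePerFlow/Lines/relay_L1.lean` (ns-idea-5 g13, crux-write 9a0bf661f4ac; the D♭-plan's first lemma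
§PLAN-L1 of `Lines/relay.lean` REV 2, critic idea-crit-4 g10 price P2, PAID), so that it is importable by Theorems files (a Theorems
file may not import a `Cruxes/` workfile).  For a finite family of fields `vᵢ` on `ℝ³` with pairwise disjoint closed supports
(`tsupport`) and `V = Σᵢ vᵢ`:

* pointwise, every germ-local functional vanishing at `0` is additive over the family (`local_sum_eq`), whence
  `J(V) = Σᵢ J(vᵢ)`, `Z(V) = Σᵢ Z(vᵢ)`, `P(V) = Σᵢ P(vᵢ)` (`stretching_sum`, `enstrophy_sum`, `palinstrophy_sum`) and every pointwise
  bound of `V` bounds each `vᵢ` (`cell_bound_of_sum_bound`);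
* DOMINATION WITH CROWD-INDEPENDENT WEIGHTS (`relay_domination`): for every pointwise bound `M'` of `V`,
  `|J(V)| ≤ (Σᵢ wᵢ qᵢ) · M' · √Z(V) · √P(V)` with `wᵢ = √(ZᵢPᵢ)/(√Z(V)√P(V))`, `qᵢ = |Jᵢ|/(hᵢ√Zᵢ√Pᵢ)` (`hᵢ` any positive height not
  exceeding a value of `‖vᵢ‖`), and `Σᵢ wᵢ ≤ 1` (Cauchy–Schwarz), `0 ≤ wᵢ` — the shape of the DOMINATION clause of the heart D♭
  `CellRelayDecomposition` at one instant, for genuinely separated cells.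

In words: `N` synchronised copies of one cell have at most the quotient of one cell; a crowd's quotient is a sub-convex combination of its
cells' quotients.  The error-term version L1′ for partitions of a real analytic flow (never disjointly supported) is NOT typed here.
HONEST FRAMING: vector calculus + Cauchy–Schwarz; nothing about Navier–Stokes is used or proved; D♭, ⟨26567⟩ and NS regularity are OPEN;
no summit is proved by a line. [folklore]
-/

noncomputable section

open MeasureTheory Filter Topology Finset
open scoped Topology InnerProductSpace RealInnerProductSpace ENNReal ContDiff
open Literature.Analysis.FluidPDE

namespace Summit.NavierStokesRegularity.NavierStokesRegularity.Theorems.NearExtremalTransiencePerFlow.PinnedDepletion.DisjointCells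

-- the summit's namespace repeats the problem name by convention (D-0017)
set_option linter.dupNamespace false

variable {ι : Type*} [Fintype ι]

/-- The pointwise alternative for a pairwise disjointly supported finite family: near `x` either exactly one cell is alive and the sum
IS that cell, or all cells vanish and so does the sum. [folklore] -/
theorem germ_alternative (v : ι → EuclideanSpace ℝ (Fin 3) → EuclideanSpace ℝ (Fin 3))
    (hdisj : Pairwise fun i j => Disjoint (tsupport (v i)) (tsupport (v j))) (x : EuclideanSpace ℝ (Fin 3)) :
    (∃ i₀, ((fun y => ∑ i, v i y) =ᶠ[𝓝 x] v i₀) ∧ ∀ j, j ≠ i₀ → v j =ᶠ[𝓝 x] 0) ∨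
      (((fun y => ∑ i, v i y) =ᶠ[𝓝 x] 0) ∧ ∀ j, v j =ᶠ[𝓝 x] 0) := by
  by_cases hx : ∃ i₀, x ∈ tsupport (v i₀)
  · obtain ⟨i₀, hi₀⟩ := hx
    have hother : ∀ j, j ≠ i₀ → v j =ᶠ[𝓝 x] 0 := by
      intro j hj
      apply notMem_tsupport_iff_eventuallyEq.mp
      intro hxj
      exact Set.disjoint_left.mp (hdisj hj) hxj hi₀
    refine Or.inl ⟨i₀, ?_, hother⟩
    have hall : ∀ᶠ y in 𝓝 x, ∀ j, j ≠ i₀ → v j y = 0 := by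
      refine eventually_all.mpr fun j => ?_
      by_cases hj : j = i₀
      · exact Eventually.of_forall fun y h => (h hj).elim
      · exact (hother j hj).mono fun y hy _ => hy
    refine hall.mono fun y hy => ?_
    show ∑ i, v i y = v i₀ y
    exact Finset.sum_eq_single i₀ (fun j _ hj => hy j hj) (fun h => (h (Finset.mem_univ _)).elim)
  · push Not at hx
    have hall0 : ∀ j, v j =ᶠ[𝓝 x] 0 := fun j => notMem_tsupport_iff_eventuallyEq.mp (hx j)
    refine Or.inr ⟨?_, hall0⟩
    have hall : ∀ᶠ y in 𝓝 x, ∀ j, v j y = 0 :=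
      eventually_all.mpr fun j => (hall0 j).mono fun y hy => hy
    refine hall.mono fun y hy => ?_
    show ∑ i, v i y = (0 : EuclideanSpace ℝ (Fin 3) → EuclideanSpace ℝ (Fin 3)) y
    simp [hy]

/-- Additivity of any GERM-LOCAL functional vanishing at the zero field over a disjointly supported family. [folklore] -/
theorem local_sum_eq (Φ : (EuclideanSpace ℝ (Fin 3) → EuclideanSpace ℝ (Fin 3)) → EuclideanSpace ℝ (Fin 3) → ℝ)
    (hloc : ∀ (f g : EuclideanSpace ℝ (Fin 3) → EuclideanSpace ℝ (Fin 3)) (x : EuclideanSpace ℝ (Fin 3)),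
      f =ᶠ[𝓝 x] g → Φ f x = Φ g x)
    (hzero : ∀ x, Φ 0 x = 0)
    (v : ι → EuclideanSpace ℝ (Fin 3) → EuclideanSpace ℝ (Fin 3))
    (hdisj : Pairwise fun i j => Disjoint (tsupport (v i)) (tsupport (v j))) (x : EuclideanSpace ℝ (Fin 3)) :
    Φ (fun y => ∑ i, v i y) x = ∑ i, Φ (v i) x := by
  rcases germ_alternative v hdisj x with ⟨i₀, hV, hother⟩ | ⟨hV, hall⟩
  · rw [hloc _ _ x hV]
    symm
    refine Finset.sum_eq_single i₀ (fun j _ hj => ?_) (fun h => (h (Finset.mem_univ _)).elim)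
    rw [hloc _ _ x (hother j hj), hzero]
  · rw [hloc _ _ x hV, hzero]
    symm
    exact Finset.sum_eq_zero fun j _ => by rw [hloc _ _ x (hall j), hzero]

/-- Germs determine the germ of `curl` (via `curl_congr_of_eventuallyEq`). [folklore] -/
theorem curl_eventuallyEq_of_eventuallyEq {f g : EuclideanSpace ℝ (Fin 3) → EuclideanSpace ℝ (Fin 3)}
    {x : EuclideanSpace ℝ (Fin 3)} (h : f =ᶠ[𝓝 x] g) : curl f =ᶠ[𝓝 x] curl g :=
  h.eventuallyEq_nhds.mono fun _ hy => curl_congr_of_eventuallyEq hy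

/-- `curl 0 = 0` as functions. [folklore] -/
theorem curl_zero_pi : curl (0 : EuclideanSpace ℝ (Fin 3) → EuclideanSpace ℝ (Fin 3)) = 0 :=
  funext fun x => curl_zero x

/-- The stretching density `⟪ω, ∇v ω⟫` is germ-local and vanishes at `0`; hence additive (`local_sum_eq`). [folklore] -/
theorem stretching_density_sum (v : ι → EuclideanSpace ℝ (Fin 3) → EuclideanSpace ℝ (Fin 3))
    (hdisj : Pairwise fun i j => Disjoint (tsupport (v i)) (tsupport (v j))) (x : EuclideanSpace ℝ (Fin 3)) :
    ⟪curl (fun y => ∑ i, v i y) x, fderiv ℝ (fun y => ∑ i, v i y) x (curl (fun y => ∑ i, v i y) x)⟫_ℝ =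
      ∑ i, ⟪curl (v i) x, fderiv ℝ (v i) x (curl (v i) x)⟫_ℝ := by
  refine local_sum_eq (fun f x => ⟪curl f x, fderiv ℝ f x (curl f x)⟫_ℝ) ?_ ?_ v hdisj x
  · intro f g x h
    simp only [curl_congr_of_eventuallyEq h, h.fderiv_eq]
  · intro x
    simp

/-- The enstrophy density `‖ω‖²` is additive over a disjointly supported family. [folklore] -/
theorem enstrophy_density_sum (v : ι → EuclideanSpace ℝ (Fin 3) → EuclideanSpace ℝ (Fin 3))
    (hdisj : Pairwise fun i j => Disjoint (tsupport (v i)) (tsupport (v j))) (x : EuclideanSpace ℝ (Fin 3)) :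
    ‖curl (fun y => ∑ i, v i y) x‖ ^ 2 = ∑ i, ‖curl (v i) x‖ ^ 2 := by
  refine local_sum_eq (fun f x => ‖curl f x‖ ^ 2) ?_ ?_ v hdisj x
  · intro f g x h
    simp only [curl_congr_of_eventuallyEq h]
  · intro x
    simp

/-- The palinstrophy density `|∇ω|²` is additive over a disjointly supported family. [folklore] -/
theorem palinstrophy_density_sum (v : ι → EuclideanSpace ℝ (Fin 3) → EuclideanSpace ℝ (Fin 3))
    (hdisj : Pairwise fun i j => Disjoint (tsupport (v i)) (tsupport (v j))) (x : EuclideanSpace ℝ (Fin 3)) :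
    frobeniusNormSq (fderiv ℝ (curl (fun y => ∑ i, v i y)) x) = ∑ i, frobeniusNormSq (fderiv ℝ (curl (v i)) x) := by
  refine local_sum_eq (fun f x => frobeniusNormSq (fderiv ℝ (curl f) x)) ?_ ?_ v hdisj x
  · intro f g x h
    simp only [(curl_eventuallyEq_of_eventuallyEq h).fderiv_eq]
  · intro x
    simp [curl_zero_pi, frobeniusNormSq]

/-- Every pointwise bound of the sum bounds each cell (the sum IS the cell on the cell's support). [folklore] -/
theorem cell_bound_of_sum_bound (v : ι → EuclideanSpace ℝ (Fin 3) → EuclideanSpace ℝ (Fin 3))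
    (hdisj : Pairwise fun i j => Disjoint (tsupport (v i)) (tsupport (v j))) {M' : ℝ}
    (hM : ∀ x, ‖∑ i, v i x‖ ≤ M') (i : ι) (x : EuclideanSpace ℝ (Fin 3)) : ‖v i x‖ ≤ M' := by
  have hM0 : 0 ≤ M' := (norm_nonneg _).trans (hM x)
  by_cases hx : x ∈ tsupport (v i)
  · rcases germ_alternative v hdisj x with ⟨i₀, hV, hother⟩ | ⟨hV, hall⟩
    · by_cases hi : i = i₀
      · subst hi
        have := hV.eq_of_nhds
        rw [← this]; exact hM x
      · have h0 : v i x = 0 := by simpa using (hother i hi).eq_of_nhds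
        rw [h0, norm_zero]; exact hM0
    · have h0 : v i x = 0 := by simpa using (hall i).eq_of_nhds
      rw [h0, norm_zero]; exact hM0
  · rw [image_eq_zero_of_notMem_tsupport hx, norm_zero]; exact hM0

/-- Integrated additivity of the stretching: `J(V) = Σ Jᵢ` (under integrability of each cell's density). [folklore] -/
theorem stretching_sum (v : ι → EuclideanSpace ℝ (Fin 3) → EuclideanSpace ℝ (Fin 3))
    (hdisj : Pairwise fun i j => Disjoint (tsupport (v i)) (tsupport (v j)))
    (hint : ∀ i, Integrable fun x => ⟪curl (v i) x, fderiv ℝ (v i) x (curl (v i) x)⟫_ℝ) :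
    ∫ x, ⟪curl (fun y => ∑ i, v i y) x, fderiv ℝ (fun y => ∑ i, v i y) x (curl (fun y => ∑ i, v i y) x)⟫_ℝ =
      ∑ i, ∫ x, ⟪curl (v i) x, fderiv ℝ (v i) x (curl (v i) x)⟫_ℝ := by
  simp_rw [stretching_density_sum v hdisj]
  exact integral_finsetSum _ fun i _ => hint i

/-- Integrated additivity of the enstrophy: `Z(V) = Σ Zᵢ`. [folklore] -/
theorem enstrophy_sum (v : ι → EuclideanSpace ℝ (Fin 3) → EuclideanSpace ℝ (Fin 3))
    (hdisj : Pairwise fun i j => Disjoint (tsupport (v i)) (tsupport (v j)))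
    (hint : ∀ i, Integrable fun x => ‖curl (v i) x‖ ^ 2) :
    ∫ x, ‖curl (fun y => ∑ i, v i y) x‖ ^ 2 = ∑ i, ∫ x, ‖curl (v i) x‖ ^ 2 := by
  simp_rw [enstrophy_density_sum v hdisj]
  exact integral_finsetSum _ fun i _ => hint i

/-- Integrated additivity of the palinstrophy: `P(V) = Σ Pᵢ`. [folklore] -/
theorem palinstrophy_sum (v : ι → EuclideanSpace ℝ (Fin 3) → EuclideanSpace ℝ (Fin 3))
    (hdisj : Pairwise fun i j => Disjoint (tsupport (v i)) (tsupport (v j)))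
    (hint : ∀ i, Integrable fun x => frobeniusNormSq (fderiv ℝ (curl (v i)) x)) :
    ∫ x, frobeniusNormSq (fderiv ℝ (curl (fun y => ∑ i, v i y)) x) =
      ∑ i, ∫ x, frobeniusNormSq (fderiv ℝ (curl (v i)) x) := by
  simp_rw [palinstrophy_density_sum v hdisj]
  exact integral_finsetSum _ fun i _ => hint i

/-- Cauchy–Schwarz for the crowd weights: `Σᵢ √Zᵢ √Pᵢ ≤ √(Σ Zᵢ) √(Σ Pᵢ)` for nonnegative families. [folklore] -/
theorem sum_sqrt_mul_sqrt_le (Z P : ι → ℝ) (hZ : ∀ i, 0 ≤ Z i) (hP : ∀ i, 0 ≤ P i) :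
    ∑ i, Real.sqrt (Z i) * Real.sqrt (P i) ≤ Real.sqrt (∑ i, Z i) * Real.sqrt (∑ i, P i) := by
  have h := Real.sum_mul_le_sqrt_mul_sqrt Finset.univ (fun i => Real.sqrt (Z i)) (fun i => Real.sqrt (P i))
  simp only [Real.sq_sqrt (hZ _), Real.sq_sqrt (hP _)] at h
  exact h

/-- **L1 — RELAY DOMINATION for disjointly supported cells (exact sub-convexity of the depletion quotient).**
With `V = Σᵢ vᵢ`, `Zᵢ, Pᵢ, Jᵢ` the cells' enstrophy / palinstrophy / stretching, heights `0 < hᵢ ≤ ‖vᵢ(xᵢ)‖` for some `xᵢ`,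
weights `wᵢ = √Zᵢ√Pᵢ/(√Z(V)√P(V))` and quotients `qᵢ = |Jᵢ|/(hᵢ√Zᵢ√Pᵢ)`: for EVERY pointwise bound `M'` of `V`,
`|J(V)| ≤ (Σᵢ wᵢ qᵢ)·M'·√Z(V)·√P(V)`, and `Σᵢ wᵢ ≤ 1`, `0 ≤ wᵢ` — the weights do not depend on `M'` or on the number of cells.
(The user supplies `qᵢ ≤ κ⋆` from the sharp slice inequality when `hᵢ = sup ‖vᵢ‖`.)  Planner's annex proof (ns-idea-5 g13),
verbatim. [folklore] -/
theorem relay_domination (v : ι → EuclideanSpace ℝ (Fin 3) → EuclideanSpace ℝ (Fin 3))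
    (hdisj : Pairwise fun i j => Disjoint (tsupport (v i)) (tsupport (v j)))
    (hJ : ∀ i, Integrable fun x => ⟪curl (v i) x, fderiv ℝ (v i) x (curl (v i) x)⟫_ℝ)
    (hZ : ∀ i, Integrable fun x => ‖curl (v i) x‖ ^ 2)
    (hP : ∀ i, Integrable fun x => frobeniusNormSq (fderiv ℝ (curl (v i)) x))
    (hZpos : ∀ i, 0 < ∫ x, ‖curl (v i) x‖ ^ 2)
    (hPpos : ∀ i, 0 < ∫ x, frobeniusNormSq (fderiv ℝ (curl (v i)) x))
    (h : ι → ℝ) (hhpos : ∀ i, 0 < h i) (hhle : ∀ i, ∃ x, h i ≤ ‖v i x‖) :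
    let V : EuclideanSpace ℝ (Fin 3) → EuclideanSpace ℝ (Fin 3) := fun y => ∑ i, v i y
    let Z : ι → ℝ := fun i => ∫ x, ‖curl (v i) x‖ ^ 2
    let P : ι → ℝ := fun i => ∫ x, frobeniusNormSq (fderiv ℝ (curl (v i)) x)
    let J : ι → ℝ := fun i => ∫ x, ⟪curl (v i) x, fderiv ℝ (v i) x (curl (v i) x)⟫_ℝ
    let ZV : ℝ := ∫ x, ‖curl V x‖ ^ 2
    let PV : ℝ := ∫ x, frobeniusNormSq (fderiv ℝ (curl V) x)
    let w : ι → ℝ := fun i => Real.sqrt (Z i) * Real.sqrt (P i) / (Real.sqrt ZV * Real.sqrt PV)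
    let q : ι → ℝ := fun i => |J i| / (h i * Real.sqrt (Z i) * Real.sqrt (P i))
    (∀ i, 0 ≤ w i) ∧ (∑ i, w i ≤ 1) ∧
      ∀ M' : ℝ, (∀ x, ‖V x‖ ≤ M') →
        |∫ x, ⟪curl V x, fderiv ℝ V x (curl V x)⟫_ℝ| ≤ (∑ i, w i * q i) * M' * Real.sqrt ZV * Real.sqrt PV := by
  intro V Z P J ZV PV w q
  have hZV : ZV = ∑ i, Z i := enstrophy_sum v hdisj hZ
  have hPV : PV = ∑ i, P i := palinstrophy_sum v hdisj hP
  have hJV : (∫ x, ⟪curl V x, fderiv ℝ V x (curl V x)⟫_ℝ) = ∑ i, J i := stretching_sum v hdisj hJ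
  have hZnn : ∀ i, 0 ≤ Z i := fun i => (hZpos i).le
  have hPnn : ∀ i, 0 ≤ P i := fun i => (hPpos i).le
  have hZVnn : 0 ≤ ZV := hZV ▸ Finset.sum_nonneg fun i _ => hZnn i
  have hPVnn : 0 ≤ PV := hPV ▸ Finset.sum_nonneg fun i _ => hPnn i
  have hden_nn : 0 ≤ Real.sqrt ZV * Real.sqrt PV := mul_nonneg (Real.sqrt_nonneg _) (Real.sqrt_nonneg _)
  have hw0 : ∀ i, 0 ≤ w i := fun i =>
    div_nonneg (mul_nonneg (Real.sqrt_nonneg _) (Real.sqrt_nonneg _)) hden_nn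
  -- Cauchy–Schwarz: Σ √Zᵢ√Pᵢ ≤ √ZV √PV
  have hCS : ∑ i, Real.sqrt (Z i) * Real.sqrt (P i) ≤ Real.sqrt ZV * Real.sqrt PV := by
    rw [hZV, hPV]; exact sum_sqrt_mul_sqrt_le Z P hZnn hPnn
  have hsumw : ∑ i, w i ≤ 1 := by
    show ∑ i, Real.sqrt (Z i) * Real.sqrt (P i) / (Real.sqrt ZV * Real.sqrt PV) ≤ 1
    rw [← Finset.sum_div]
    rcases hden_nn.lt_or_eq with hpos | hzero
    · rw [div_le_one hpos]; exact hCS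
    · rw [← hzero, div_zero]; exact zero_le_one
  refine ⟨hw0, hsumw, fun M' hM => ?_⟩
  -- each cell is bounded by M', hence hᵢ ≤ M'
  have hhM : ∀ i, h i ≤ M' := fun i => by
    obtain ⟨x, hx⟩ := hhle i
    exact hx.trans (cell_bound_of_sum_bound v hdisj hM i x)
  -- |Jᵢ| = qᵢ hᵢ √Zᵢ √Pᵢ ≤ qᵢ M' √Zᵢ √Pᵢ
  have hq0 : ∀ i, 0 ≤ q i := fun i =>
    div_nonneg (abs_nonneg _) (mul_nonneg (mul_nonneg (hhpos i).le (Real.sqrt_nonneg _)) (Real.sqrt_nonneg _))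
  have hcell : ∀ i, |J i| ≤ q i * M' * (Real.sqrt (Z i) * Real.sqrt (P i)) := by
    intro i
    have hden : 0 < h i * Real.sqrt (Z i) * Real.sqrt (P i) :=
      mul_pos (mul_pos (hhpos i) (Real.sqrt_pos.mpr (hZpos i))) (Real.sqrt_pos.mpr (hPpos i))
    have hJeq : |J i| = q i * (h i * Real.sqrt (Z i) * Real.sqrt (P i)) := by
      show |J i| = |J i| / (h i * Real.sqrt (Z i) * Real.sqrt (P i)) * (h i * Real.sqrt (Z i) * Real.sqrt (P i))
      rw [div_mul_cancel₀ _ hden.ne']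
    rw [hJeq]
    have : q i * (h i * Real.sqrt (Z i) * Real.sqrt (P i)) = q i * h i * (Real.sqrt (Z i) * Real.sqrt (P i)) := by ring
    rw [this]
    exact mul_le_mul_of_nonneg_right (mul_le_mul_of_nonneg_left (hhM i) (hq0 i))
      (mul_nonneg (Real.sqrt_nonneg _) (Real.sqrt_nonneg _))
  -- sum up
  calc |∫ x, ⟪curl V x, fderiv ℝ V x (curl V x)⟫_ℝ| = |∑ i, J i| := by rw [hJV]
    _ ≤ ∑ i, |J i| := Finset.abs_sum_le_sum_abs _ _
    _ ≤ ∑ i, q i * M' * (Real.sqrt (Z i) * Real.sqrt (P i)) := Finset.sum_le_sum fun i _ => hcell i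
    _ = (∑ i, w i * q i) * M' * Real.sqrt ZV * Real.sqrt PV := by
        rcases hden_nn.lt_or_eq with hpos | hzero
        · have hw : ∀ i, w i * (Real.sqrt ZV * Real.sqrt PV) = Real.sqrt (Z i) * Real.sqrt (P i) := fun i =>
            div_mul_cancel₀ _ hpos.ne'
          have hterm : ∀ i, q i * M' * (Real.sqrt (Z i) * Real.sqrt (P i)) =
              w i * q i * (M' * (Real.sqrt ZV * Real.sqrt PV)) := fun i => by rw [← hw i]; ring
          rw [Finset.sum_congr rfl (fun i _ => hterm i), ← Finset.sum_mul]; ring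
        · -- degenerate: √ZV·√PV = 0 forces every √Zᵢ√Pᵢ = 0 (by Cauchy–Schwarz), so both sides vanish
          have hle : ∑ i, Real.sqrt (Z i) * Real.sqrt (P i) ≤ 0 := by rw [hzero]; exact hCS
          have heach : ∀ i, Real.sqrt (Z i) * Real.sqrt (P i) = 0 := by
            intro i
            have hnn : ∀ j ∈ Finset.univ, 0 ≤ Real.sqrt (Z j) * Real.sqrt (P j) := fun j _ =>
              mul_nonneg (Real.sqrt_nonneg _) (Real.sqrt_nonneg _)
            exact (Finset.sum_eq_zero_iff_of_nonneg hnn).mp (le_antisymm hle (Finset.sum_nonneg hnn)) i (Finset.mem_univ _)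
          simp only [heach, mul_zero, Finset.sum_const_zero]
          rw [mul_assoc, ← hzero, mul_zero]

/-- **L1 with the card's HEIGHT-WEIGHTED weights** (pointer of the author of record ns-idea-5 g14 / idea-crit-4 g10, 2026-08-29):
with the same data, for every pointwise bound `M'` of `V` the height-weighted weights `λᵢ := (hᵢ/M')·wᵢ`
(`wᵢ = √Zᵢ√Pᵢ/(√Z(V)√P(V))`, `qᵢ = |Jᵢ|/(hᵢ√Zᵢ√Pᵢ)`) satisfy `0 ≤ λᵢ ≤ wᵢ`, `Σᵢ λᵢ ≤ 1`, and STILL dominate: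
`|J(V)| ≤ (Σᵢ λᵢ qᵢ)·M'·√Z(V)·√P(V)` — in fact `Σᵢ λᵢqᵢ·M'√Z√P = Σᵢ |Jᵢ|`, so this is the sharp form of `relay_domination`
(the card's `λᵢ = (hᵢ/h)·√(ZᵢPᵢ)/√(ZP)` at `M' = h = max hⱼ`).  A tall crowd member at height `hᵢ ≪ M'` is discounted by `hᵢ/M'`. [folklore] -/
theorem relay_domination_heightWeighted (v : ι → EuclideanSpace ℝ (Fin 3) → EuclideanSpace ℝ (Fin 3))
    (hdisj : Pairwise fun i j => Disjoint (tsupport (v i)) (tsupport (v j)))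
    (hJ : ∀ i, Integrable fun x => ⟪curl (v i) x, fderiv ℝ (v i) x (curl (v i) x)⟫_ℝ)
    (hZ : ∀ i, Integrable fun x => ‖curl (v i) x‖ ^ 2)
    (hP : ∀ i, Integrable fun x => frobeniusNormSq (fderiv ℝ (curl (v i)) x))
    (hZpos : ∀ i, 0 < ∫ x, ‖curl (v i) x‖ ^ 2)
    (hPpos : ∀ i, 0 < ∫ x, frobeniusNormSq (fderiv ℝ (curl (v i)) x))
    (h : ι → ℝ) (hhpos : ∀ i, 0 < h i) (hhle : ∀ i, ∃ x, h i ≤ ‖v i x‖) :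
    let V : EuclideanSpace ℝ (Fin 3) → EuclideanSpace ℝ (Fin 3) := fun y => ∑ i, v i y
    let Z : ι → ℝ := fun i => ∫ x, ‖curl (v i) x‖ ^ 2
    let P : ι → ℝ := fun i => ∫ x, frobeniusNormSq (fderiv ℝ (curl (v i)) x)
    let J : ι → ℝ := fun i => ∫ x, ⟪curl (v i) x, fderiv ℝ (v i) x (curl (v i) x)⟫_ℝ
    let ZV : ℝ := ∫ x, ‖curl V x‖ ^ 2
    let PV : ℝ := ∫ x, frobeniusNormSq (fderiv ℝ (curl V) x)
    let w : ι → ℝ := fun i => Real.sqrt (Z i) * Real.sqrt (P i) / (Real.sqrt ZV * Real.sqrt PV)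
    let q : ι → ℝ := fun i => |J i| / (h i * Real.sqrt (Z i) * Real.sqrt (P i))
    ∀ M' : ℝ, (∀ x, ‖V x‖ ≤ M') →
      (∀ i, 0 ≤ h i / M' * w i) ∧ (∀ i, h i / M' * w i ≤ w i) ∧ (∑ i, h i / M' * w i ≤ 1) ∧
        |∫ x, ⟪curl V x, fderiv ℝ V x (curl V x)⟫_ℝ| ≤ (∑ i, (h i / M' * w i) * q i) * M' * Real.sqrt ZV * Real.sqrt PV := by
  intro V Z P J ZV PV w q M' hM
  obtain ⟨hw0, hsumw, -⟩ := relay_domination v hdisj hJ hZ hP hZpos hPpos h hhpos hhle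
  have hZV : ZV = ∑ i, Z i := enstrophy_sum v hdisj hZ
  have hPV : PV = ∑ i, P i := palinstrophy_sum v hdisj hP
  have hJV : (∫ x, ⟪curl V x, fderiv ℝ V x (curl V x)⟫_ℝ) = ∑ i, J i := stretching_sum v hdisj hJ
  have hZnn : ∀ i, 0 ≤ Z i := fun i => (hZpos i).le
  have hPnn : ∀ i, 0 ≤ P i := fun i => (hPpos i).le
  have hden_nn : 0 ≤ Real.sqrt ZV * Real.sqrt PV := mul_nonneg (Real.sqrt_nonneg _) (Real.sqrt_nonneg _)
  -- each cell is bounded by `M'`, hence `0 < hᵢ ≤ M'`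
  have hhM : ∀ i, h i ≤ M' := fun i => by
    obtain ⟨x, hx⟩ := hhle i
    exact hx.trans (cell_bound_of_sum_bound v hdisj hM i x)
  have hratio0 : ∀ i, 0 ≤ h i / M' := fun i => div_nonneg (hhpos i).le ((hhpos i).le.trans (hhM i))
  have hratio1 : ∀ i, h i / M' ≤ 1 := fun i => div_le_one_of_le₀ (hhM i) ((hhpos i).le.trans (hhM i))
  have hlam0 : ∀ i, 0 ≤ h i / M' * w i := fun i => mul_nonneg (hratio0 i) (hw0 i)
  have hlamw : ∀ i, h i / M' * w i ≤ w i := fun i => by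
    have := mul_le_mul_of_nonneg_right (hratio1 i) (hw0 i)
    simpa only [one_mul] using this
  refine ⟨hlam0, hlamw, (Finset.sum_le_sum fun i _ => hlamw i).trans hsumw, ?_⟩
  -- the sharp identity `λᵢ qᵢ M' √ZV √PV = |Jᵢ|` (non-degenerate case) and the triangle inequality
  have hcell : ∀ i, |J i| = q i * h i * (Real.sqrt (Z i) * Real.sqrt (P i)) := by
    intro i
    have hden : 0 < h i * Real.sqrt (Z i) * Real.sqrt (P i) :=
      mul_pos (mul_pos (hhpos i) (Real.sqrt_pos.mpr (hZpos i))) (Real.sqrt_pos.mpr (hPpos i))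
    have hJeq : |J i| = |J i| / (h i * Real.sqrt (Z i) * Real.sqrt (P i)) * (h i * Real.sqrt (Z i) * Real.sqrt (P i)) := by
      rw [div_mul_cancel₀ _ hden.ne']
    rw [hJeq]
    show _ = |J i| / (h i * Real.sqrt (Z i) * Real.sqrt (P i)) * h i * (Real.sqrt (Z i) * Real.sqrt (P i))
    ring
  calc |∫ x, ⟪curl V x, fderiv ℝ V x (curl V x)⟫_ℝ| = |∑ i, J i| := by rw [hJV]
    _ ≤ ∑ i, |J i| := Finset.abs_sum_le_sum_abs _ _
    _ = ∑ i, q i * h i * (Real.sqrt (Z i) * Real.sqrt (P i)) := Finset.sum_congr rfl fun i _ => hcell i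
    _ = (∑ i, (h i / M' * w i) * q i) * M' * Real.sqrt ZV * Real.sqrt PV := by
        rcases hden_nn.lt_or_eq with hpos | hzero
        · have hM'pos : 0 < M' := by
            -- `ι` is nonempty in this branch (else `ZV = 0`), and `0 < hᵢ ≤ M'`
            by_contra hle
            push Not at hle
            have hempty : ∀ i : ι, False := fun i => absurd ((hhpos i).trans_le (hhM i)) (not_lt.2 hle)
            have hZ0 : ZV = 0 := by
              rw [hZV]; exact Finset.sum_eq_zero fun i _ => (hempty i).elim
            rw [hZ0, Real.sqrt_zero, zero_mul] at hpos
            exact lt_irrefl _ hpos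
          have hw : ∀ i, w i * (Real.sqrt ZV * Real.sqrt PV) = Real.sqrt (Z i) * Real.sqrt (P i) := fun i =>
            div_mul_cancel₀ _ hpos.ne'
          have hterm : ∀ i, q i * h i * (Real.sqrt (Z i) * Real.sqrt (P i)) =
              (h i / M' * w i) * q i * (M' * (Real.sqrt ZV * Real.sqrt PV)) := fun i => by
            rw [← hw i]
            field_simp
          rw [Finset.sum_congr rfl (fun i _ => hterm i), ← Finset.sum_mul]; ring
        · -- degenerate: √ZV·√PV = 0 forces `ι` empty (each `√Zᵢ√Pᵢ > 0`), so both sides vanish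
          have hCS : ∑ i, Real.sqrt (Z i) * Real.sqrt (P i) ≤ Real.sqrt ZV * Real.sqrt PV := by
            rw [hZV, hPV]; exact sum_sqrt_mul_sqrt_le Z P hZnn hPnn
          have hle : ∑ i, Real.sqrt (Z i) * Real.sqrt (P i) ≤ 0 := by rw [hzero]; exact hCS
          have heach : ∀ i, Real.sqrt (Z i) * Real.sqrt (P i) = 0 := by
            intro i
            have hnn : ∀ j ∈ Finset.univ, 0 ≤ Real.sqrt (Z j) * Real.sqrt (P j) := fun j _ =>
              mul_nonneg (Real.sqrt_nonneg _) (Real.sqrt_nonneg _)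
            exact (Finset.sum_eq_zero_iff_of_nonneg hnn).mp (le_antisymm hle (Finset.sum_nonneg hnn)) i (Finset.mem_univ _)
          simp only [heach, mul_zero, Finset.sum_const_zero]
          rw [mul_assoc, ← hzero, mul_zero]

end Summit.NavierStokesRegularity.NavierStokesRegularity.Theorems.NearExtremalTransiencePerFlow.PinnedDepletion.DisjointCells

end
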